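import Literature.Probability.Process.BrownianVec
import HarnessLib

/-!
# Route `ColdStartUniversality`, rung `stub_fixedCutoffMixing` of K_A1 (stmt-QuantumFields-24809):
# the partition argument of the Taylor route to Dynkin's formula in expectation

Helper file (seat `ym-line-csu-p1`, g6) for the `WilsonMeasureLangevinInvariant` wall of the rung
(step 2).  The Dynkin / Itô formula in expectation `E[Z f(X_t)] - E[Z f(X_s)] = E[Z ∫_{(s,t]} (Lf)_r dr]`
is obtained from a **one-cell estimate** `|E[Z f(X_v)] - E[Z f(X_u)] - E[Z ∫_{(u,v]} (Lf)_r dr]| ≤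
K (v - u)^{3/2}` (second-order Taylor expansion, `u ≤ v`, `v - u ≤ 1`) by summing over the uniform
partition of `[s, t]` into `n` cells and letting `n → ∞` (`n · K ((t-s)/n)^{3/2} → 0`).  This file
isolates that elementary step in abstract form:

* `eq_of_cell_estimate` — for `Φ : ℝ≥0 → ℝ` and an additive two-time functional `Λ`
  (`Λ u v + Λ v w = Λ u w`), the cell estimate `|Φ v - Φ u - Λ u v| ≤ K (v - u)^{3/2}` on short cells
  of `[s, t]` forces `Φ t - Φ s = Λ s t`.

No probability here; no definition, no sorry, standard axioms.  RECORD-rung plumbing (R3); the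
Yang–Mills mass gap is NOT proved.
-/

set_option autoImplicit false

noncomputable section

namespace Summit.QuantumFields.YangMills.Theorems.ColdStartUniversality

open Filter Finset
open scoped NNReal Topology
open Literature.Probability.Process

/-- Telescoping over the uniform grid: `Φ t - Φ s - Λ s t = ∑_{l<n} (Φ r_{l+1} - Φ r_l - Λ r_l r_{l+1})`
for an additive `Λ`. [folklore] -/
theorem sub_sub_eq_sum_grid {Φ : ℝ≥0 → ℝ} {Λ : ℝ≥0 → ℝ≥0 → ℝ}
    (hΛ : ∀ u v w, u ≤ v → v ≤ w → Λ u v + Λ v w = Λ u w) (hΛ0 : ∀ u, Λ u u = 0)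
    {s t : ℝ≥0} (hst : s ≤ t) {n : ℕ} (hn : n ≠ 0) :
    Φ t - Φ s - Λ s t = ∑ l ∈ range n,
      (Φ (IsBrownianVec.grid s t n (l + 1)) - Φ (IsBrownianVec.grid s t n l) -
        Λ (IsBrownianVec.grid s t n l) (IsBrownianVec.grid s t n (l + 1))) := by
  -- partial version: for every `m ≤ n`
  have key : ∀ m, m ≤ n → Φ (IsBrownianVec.grid s t n m) - Φ s - Λ s (IsBrownianVec.grid s t n m) =
      ∑ l ∈ range m, (Φ (IsBrownianVec.grid s t n (l + 1)) - Φ (IsBrownianVec.grid s t n l) -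
        Λ (IsBrownianVec.grid s t n l) (IsBrownianVec.grid s t n (l + 1))) := by
    intro m hm
    induction m with
    | zero => simp [IsBrownianVec.grid_zero, hΛ0]
    | succ m ih =>
      have ih' := ih (by omega)
      rw [sum_range_succ, ← ih']
      have hadd := hΛ s (IsBrownianVec.grid s t n m) (IsBrownianVec.grid s t n (m + 1))
        (IsBrownianVec.le_grid s t n m) (by rw [IsBrownianVec.grid_succ]; exact le_self_add)
      linarith
  have h := key n le_rfl
  rwa [IsBrownianVec.grid_self hst hn] at h

/-- **From the one-cell estimate to the identity.**  Let `Φ : ℝ≥0 → ℝ`, let `Λ` be additive over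
adjacent cells with `Λ u u = 0`, and suppose that on every cell `s ≤ u ≤ v ≤ t` of length
`v - u ≤ 1` the one-cell estimate `|Φ v - Φ u - Λ u v| ≤ K (v - u)^{3/2}` holds.  Then
`Φ t - Φ s = Λ s t` (sum over the uniform partition into `n` cells: the total error is
`≤ K (t-s)^{3/2} / √n → 0`). [folklore] -/
theorem eq_of_cell_estimate {Φ : ℝ≥0 → ℝ} {Λ : ℝ≥0 → ℝ≥0 → ℝ} {K : ℝ}
    (hΛ : ∀ u v w, u ≤ v → v ≤ w → Λ u v + Λ v w = Λ u w) (hΛ0 : ∀ u, Λ u u = 0)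
    {s t : ℝ≥0} (hst : s ≤ t)
    (hcell : ∀ u v : ℝ≥0, s ≤ u → u ≤ v → v ≤ t → (v : ℝ) - u ≤ 1 →
      |Φ v - Φ u - Λ u v| ≤ K * ((v : ℝ) - u) ^ (3 / 2 : ℝ)) :
    Φ t - Φ s = Λ s t := by
  set τ : ℝ := (t : ℝ) - s with hτ
  have hτ0 : 0 ≤ τ := sub_nonneg.2 (NNReal.coe_le_coe.2 hst)
  -- the error bound along the partitions with `n ≥ τ` cells
  have hbound : ∀ n : ℕ, n ≠ 0 → τ ≤ n → |Φ t - Φ s - Λ s t| ≤ K * τ ^ (3 / 2 : ℝ) / Real.sqrt n := by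
    intro n hn hτn
    have hn0 : (0 : ℝ) < n := by exact_mod_cast Nat.pos_of_ne_zero hn
    rw [sub_sub_eq_sum_grid hΛ hΛ0 hst hn]
    -- each cell has length `τ / n ≤ 1`
    have hcellL : ∀ l, (IsBrownianVec.grid s t n (l + 1) : ℝ) - IsBrownianVec.grid s t n l = τ / n := by
      intro l
      rw [IsBrownianVec.coe_grid hst, IsBrownianVec.coe_grid hst]
      push_cast
      ring
    have hδ1 : τ / n ≤ 1 := by rw [div_le_one hn0]; exact hτn
    have hterm : ∀ l ∈ range n, |Φ (IsBrownianVec.grid s t n (l + 1)) - Φ (IsBrownianVec.grid s t n l) -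
        Λ (IsBrownianVec.grid s t n l) (IsBrownianVec.grid s t n (l + 1))| ≤ K * (τ / n) ^ (3 / 2 : ℝ) := by
      intro l hl
      have hl' := mem_range.1 hl
      have h := hcell (IsBrownianVec.grid s t n l) (IsBrownianVec.grid s t n (l + 1))
        (IsBrownianVec.le_grid s t n l) (by rw [IsBrownianVec.grid_succ]; exact le_self_add)
        (IsBrownianVec.grid_le hst (by omega)) (by rw [hcellL l]; exact hδ1)
      rwa [hcellL l] at h
    calc |∑ l ∈ range n, (Φ (IsBrownianVec.grid s t n (l + 1)) - Φ (IsBrownianVec.grid s t n l) -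
          Λ (IsBrownianVec.grid s t n l) (IsBrownianVec.grid s t n (l + 1)))|
        ≤ ∑ l ∈ range n, |Φ (IsBrownianVec.grid s t n (l + 1)) - Φ (IsBrownianVec.grid s t n l) -
          Λ (IsBrownianVec.grid s t n l) (IsBrownianVec.grid s t n (l + 1))| := abs_sum_le_sum_abs _ _
      _ ≤ ∑ l ∈ range n, K * (τ / n) ^ (3 / 2 : ℝ) := sum_le_sum hterm
      _ = n * (K * (τ / n) ^ (3 / 2 : ℝ)) := by rw [sum_const, card_range, nsmul_eq_mul]
      _ = K * τ ^ (3 / 2 : ℝ) / Real.sqrt n := by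
        rw [Real.div_rpow hτ0 hn0.le, Real.sqrt_eq_rpow]
        have h32 : (n : ℝ) ^ (3 / 2 : ℝ) = (n : ℝ) * (n : ℝ) ^ (1 / 2 : ℝ) := by
          rw [show (3 / 2 : ℝ) = 1 + 1 / 2 by norm_num, Real.rpow_add hn0, Real.rpow_one]
        rw [h32]
        have hn12 : (0 : ℝ) < (n : ℝ) ^ (1 / 2 : ℝ) := Real.rpow_pos_of_pos hn0 _
        field_simp
  -- the bound tends to `0`
  have h1 : Tendsto (fun n : ℕ ↦ Real.sqrt n) atTop atTop := by
    rw [show (fun n : ℕ ↦ Real.sqrt n) = Real.sqrt ∘ (fun n : ℕ ↦ (n : ℝ)) from rfl]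
    exact Real.tendsto_sqrt_atTop.comp tendsto_natCast_atTop_atTop
  have hlim : Tendsto (fun n : ℕ ↦ K * τ ^ (3 / 2 : ℝ) / Real.sqrt n) atTop (𝓝 0) :=
    h1.const_div_atTop (K * τ ^ (3 / 2 : ℝ))
  have habs : |Φ t - Φ s - Λ s t| ≤ 0 := by
    refine ge_of_tendsto hlim ?_
    filter_upwards [eventually_ge_atTop ⌈τ⌉₊, eventually_ge_atTop 1] with n hn hn1
    exact hbound n (by omega) ((Nat.le_ceil τ).trans (by exact_mod_cast hn))
  have h0 : Φ t - Φ s - Λ s t = 0 := abs_nonpos_iff.1 habs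
  linarith

end Summit.QuantumFields.YangMills.Theorems.ColdStartUniversality

end
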